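import Mathlib
import HarnessLib

/-!
# Zhang (2022), Lemma 15.3 repaired (cell RULING 15e): `Σ_{q∣D} q^{−9/10} ≤ 𝓛^{1/10} + c` —
# the elementary bound behind `∏_{q∣D}(1 + q^{−9/10})² ≤ C·exp(2𝓛^{1/10})`

Topic `Literature/NumberTheory/LFunctions/Zhang2022` (Landau–Siegel audit tree; verdict-neutral).
Y. Zhang, *Discrete mean estimates and the Landau–Siegel zero*, arXiv:2211.02515v1 (2022)
[Zhang2022LandauSiegel] — **an unrefereed manuscript under adjudication; nothing in this file asserts
or denies its Theorems 1–2.** ZHANG-L discharge lane (WP15), fifth file of the chain towards the leaf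
`Typed.Section15C.Lemma153RpI` = `Lemma153Rp c′ inputs15AB` (Lemma 15.3 part 1 with the
`D`-dependent bound `‖U(s)‖ ≤ C·exp(2𝓛^{1/10})` on `Re s ≥ 9/10`, `𝓛 = log D`; cell RULING 15e:
at a prime `q ∣ D` the Euler factor of `𝒰₁ⱼ` is `(1 − q^{−s})²`, of modulus `≤ (1 + q^{−9/10})²`).
The product over `q ∣ D` is therefore `≤ exp(2 Σ_{q∣D} q^{−9/10})`, and this file PROVES the
elementary estimate

  `∃ c, ∀ D, Σ_{q ∈ primeFactors D} q^{−9/10} ≤ (log D)^{1/10} + c`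

(`sum_primeFactors_rpow_le`), WITHOUT prime-number input: if `D` has `w` prime factors then they
are `w` distinct integers `≥ 2`, so `Σ q^{−9/10} ≤ Σ_{k=2}^{w+1} k^{−9/10} ≤ 10(w+1)^{1/10}` and
`log D ≥ Σ_{q∣D} log q ≥ log (w+1)! ≥ (w+1)(log(w+1) − 1)`; for `log(w+1) − 1 ≥ 10^{10}` this gives
`10(w+1)^{1/10} ≤ ((w+1)·10^{10})^{1/10} ≤ (log D)^{1/10}`, and for smaller `w` the sum is bounded by
an absolute (huge) constant. Theorems only; no definitions, no facts.

## References

* Y. Zhang, arXiv:2211.02515v1 (2022), §15 Lemma 15.3 p. 87 (the word "bounded").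
  [cite: Zhang2022LandauSiegel, §15 Lemma 15.3 p. 87]
-/

noncomputable section

open Real Finset

namespace Literature.NumberTheory.LFunctions.Zhang2022.Lemma153Rp

/-! ## §1. Rearrangement: a set of `w` integers `≥ 2` against `{2, …, w+1}` -/

/-- For a finite set `S` of integers `≥ 2` and `f` antitone on `[2,∞)`:
`Σ_{q∈S} f(q) ≤ Σ_{k<|S|} f(k+2)` (the `k`-th smallest element of `S` is `≥ k+2`). [folklore] -/
private theorem sum_le_sum_range_of_antitone {f : ℕ → ℝ}
    (hf : ∀ m n : ℕ, 2 ≤ m → m ≤ n → f n ≤ f m) (S : Finset ℕ) (hS : ∀ q ∈ S, 2 ≤ q) :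
    ∑ q ∈ S, f q ≤ ∑ k ∈ range S.card, f (k + 2) := by
  induction S using Finset.induction_on_max with
  | empty => simp
  | insert a s hlt ih =>
    have ha : a ∉ s := fun h => lt_irrefl a (hlt a h)
    have hs2 : ∀ q ∈ s, 2 ≤ q := fun q hq => hS q (mem_insert_of_mem hq)
    have ha2 : 2 ≤ a := hS a (mem_insert_self a s)
    -- `s ⊆ [2, a)` so `s.card + 2 ≤ a`
    have hcard : s.card + 2 ≤ a := by
      have hsub : s ⊆ Ico 2 a := fun q hq => mem_Ico.mpr ⟨hs2 q hq, hlt q hq⟩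
      have := card_le_card hsub
      rw [Nat.card_Ico] at this
      omega
    rw [sum_insert ha, card_insert_of_notMem ha, sum_range_succ]
    have h1 := ih hs2
    have h2 : f a ≤ f (s.card + 2) := hf _ _ (by omega) hcard
    linarith

/-- The same for `g` monotone on `[2,∞)`: `Σ_{k<|S|} g(k+2) ≤ Σ_{q∈S} g(q)`. [folklore] -/
private theorem sum_range_le_sum_of_monotone {g : ℕ → ℝ}
    (hg : ∀ m n : ℕ, 2 ≤ m → m ≤ n → g m ≤ g n) (S : Finset ℕ) (hS : ∀ q ∈ S, 2 ≤ q) :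
    ∑ k ∈ range S.card, g (k + 2) ≤ ∑ q ∈ S, g q := by
  have h := sum_le_sum_range_of_antitone (f := fun n => -g n)
    (fun m n hm hmn => neg_le_neg (hg m n hm hmn)) S hS
  simp only [sum_neg_distrib] at h
  linarith

/-! ## §2. The two elementary sums: `Σ_{k=2}^{w+1} k^{−9/10}` and `Σ_{k=2}^{w+1} log k` -/

/-- `Σ_{k<w} (k+2)^{−9/10} ≤ 10(w+1)^{1/10}` (comparison with `∫_1^{w+1} t^{−9/10} dt`). [folklore] -/
private theorem sum_rpow_neg_le (w : ℕ) :
    ∑ k ∈ range w, ((k : ℝ) + 2) ^ (-(9 / 10 : ℝ)) ≤ 10 * ((w : ℝ) + 1) ^ (1 / 10 : ℝ) := by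
  have hanti : AntitoneOn (fun t : ℝ => t ^ (-(9 / 10 : ℝ))) (Set.Icc (1 : ℝ) (1 + w)) := by
    intro x hx y hy hxy
    exact Real.rpow_le_rpow_of_nonpos (by linarith [hx.1]) hxy (by norm_num)
  have h := hanti.sum_le_integral
  have hsum : ∑ i ∈ range w, ((1 : ℝ) + ((i + 1 : ℕ) : ℝ)) ^ (-(9 / 10 : ℝ)) =
      ∑ k ∈ range w, ((k : ℝ) + 2) ^ (-(9 / 10 : ℝ)) := by
    refine sum_congr rfl fun i _ => ?_
    push_cast; ring_nf
  rw [hsum] at h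
  have hint : ∫ x in (1 : ℝ)..1 + w, x ^ (-(9 / 10 : ℝ)) =
      (((1 : ℝ) + w) ^ (-(9 / 10 : ℝ) + 1) - (1 : ℝ) ^ (-(9 / 10 : ℝ) + 1)) / (-(9 / 10 : ℝ) + 1) :=
    integral_rpow (Or.inl (by norm_num))
  rw [hint] at h
  have hw0 : (0 : ℝ) ≤ w := Nat.cast_nonneg w
  have hpow : ((1 : ℝ) + w) ^ (-(9 / 10 : ℝ) + 1) = ((w : ℝ) + 1) ^ (1 / 10 : ℝ) := by
    rw [add_comm (1 : ℝ) w]; norm_num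
  rw [hpow, Real.one_rpow] at h
  have hnn : 0 ≤ ((w : ℝ) + 1) ^ (1 / 10 : ℝ) := Real.rpow_nonneg (by linarith) _
  calc ∑ k ∈ range w, ((k : ℝ) + 2) ^ (-(9 / 10 : ℝ))
      ≤ (((w : ℝ) + 1) ^ (1 / 10 : ℝ) - 1) / (-(9 / 10 : ℝ) + 1) := h
    _ = 10 * ((w : ℝ) + 1) ^ (1 / 10 : ℝ) - 10 := by norm_num; ring
    _ ≤ 10 * ((w : ℝ) + 1) ^ (1 / 10 : ℝ) := by linarith

/-- `(w+1)(log(w+1) − 1) ≤ Σ_{k<w} log(k+2)` (comparison with `∫_1^{w+1} log t dt`). [folklore] -/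
private theorem mul_log_sub_le_sum_log (w : ℕ) :
    ((w : ℝ) + 1) * (Real.log ((w : ℝ) + 1) - 1) ≤ ∑ k ∈ range w, Real.log ((k : ℝ) + 2) := by
  have hmono : MonotoneOn (fun t : ℝ => Real.log t) (Set.Icc (1 : ℝ) (1 + w)) := by
    intro x hx y hy hxy
    exact Real.log_le_log (by linarith [hx.1]) hxy
  have h := hmono.integral_le_sum
  have hsum : ∑ i ∈ range w, Real.log ((1 : ℝ) + ((i + 1 : ℕ) : ℝ)) =
      ∑ k ∈ range w, Real.log ((k : ℝ) + 2) := by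
    refine sum_congr rfl fun i _ => ?_
    push_cast; ring_nf
  rw [hsum] at h
  have hw0 : (0 : ℝ) ≤ w := Nat.cast_nonneg w
  have hint : ∫ x in (1 : ℝ)..1 + w, Real.log x =
      (1 + (w : ℝ)) * Real.log (1 + w) - 1 * Real.log 1 - (1 + w) + 1 := integral_log
  rw [hint, Real.log_one, mul_zero, sub_zero] at h
  calc ((w : ℝ) + 1) * (Real.log ((w : ℝ) + 1) - 1)
      = (1 + (w : ℝ)) * Real.log (1 + w) - (1 + w) := by rw [add_comm (w : ℝ) 1]; ring
    _ ≤ (1 + (w : ℝ)) * Real.log (1 + w) - (1 + w) + 1 := by linarith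
    _ ≤ _ := h

/-! ## §3. The estimate -/

/-- **`Σ_{q∣D} q^{−9/10} ≤ (log D)^{1/10} + c`** for every `D`, with an absolute constant `c`
(the elementary input of the `D`-dependent bound `‖U(s)‖ ≤ C·exp(2𝓛^{1/10})` of
`Typed.Section15C.Lemma153Rp`, cell RULING 15e: `∏_{q∣D}|1 − q^{−s}|² ≤ exp(2Σ_{q∣D}q^{−9/10})` on
`Re s ≥ 9/10`). Proof: rearrangement against `{2,…,w+1}`, `w = ω(D)`; `Σ_{k≤w+1}k^{−9/10} ≤
10(w+1)^{1/10}`; `log D ≥ Σ_{q∣D}log q ≥ (w+1)(log(w+1)−1)`; the case `log(w+1) − 1 ≥ 10^{10}` and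
the bounded case. [cite: Zhang2022LandauSiegel, §15 Lemma 15.3 p. 87] -/
theorem sum_primeFactors_rpow_le :
    ∃ c : ℝ, 0 ≤ c ∧ ∀ D : ℕ,
      ∑ q ∈ D.primeFactors, (q : ℝ) ^ (-(9 / 10 : ℝ)) ≤ Real.log D ^ (1 / 10 : ℝ) + c := by
  -- the threshold `W₀ = exp(10^10 + 1)` and the constant `c = 10 (W₀ + 1)^{1/10}`
  set W₀ : ℝ := Real.exp ((10 : ℝ) ^ 10 + 1) with hW₀
  have hW₀pos : 0 < W₀ := Real.exp_pos _
  refine ⟨10 * (W₀ + 1) ^ (1 / 10 : ℝ), by positivity, fun D => ?_⟩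
  set S := D.primeFactors with hSdef
  set w := S.card with hw
  have hS2 : ∀ q ∈ S, 2 ≤ q := fun q hq => (Nat.prime_of_mem_primeFactors hq).two_le
  -- step 1: `Σ_{q∈S} q^{-9/10} ≤ 10 (w+1)^{1/10}`
  have h1 : ∑ q ∈ S, (q : ℝ) ^ (-(9 / 10 : ℝ)) ≤ 10 * ((w : ℝ) + 1) ^ (1 / 10 : ℝ) := by
    have h := sum_le_sum_range_of_antitone (f := fun n : ℕ => (n : ℝ) ^ (-(9 / 10 : ℝ)))
      (fun m n hm hmn => Real.rpow_le_rpow_of_nonpos (by exact_mod_cast (by omega : 0 < m))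
        (by exact_mod_cast hmn) (by norm_num)) S hS2
    refine h.trans ?_
    have := sum_rpow_neg_le w
    refine le_trans (le_of_eq ?_) this
    refine sum_congr rfl fun k _ => ?_
    push_cast; ring_nf
  have hlogD0 : 0 ≤ Real.log D := Real.log_natCast_nonneg D
  have hrhs0 : 0 ≤ Real.log (D : ℝ) ^ (1 / 10 : ℝ) := Real.rpow_nonneg hlogD0 _
  by_cases hsmall : ((w : ℝ) + 1) ≤ W₀ + 1
  · -- bounded case
    have : ((w : ℝ) + 1) ^ (1 / 10 : ℝ) ≤ (W₀ + 1) ^ (1 / 10 : ℝ) :=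
      Real.rpow_le_rpow (by positivity) hsmall (by norm_num)
    nlinarith
  · -- large case: `w + 1 > W₀ + 1`, so `log(w+1) − 1 ≥ 10^10`
    push Not at hsmall
    have hw1 : W₀ < (w : ℝ) + 1 := by linarith
    have hlogw : (10 : ℝ) ^ 10 ≤ Real.log ((w : ℝ) + 1) - 1 := by
      have := Real.log_lt_log hW₀pos hw1
      rw [hW₀, Real.log_exp] at this
      linarith
    -- step 2: `log D ≥ (w+1)(log(w+1) − 1) ≥ (w+1)·10^10`
    have hD0 : D ≠ 0 := by
      intro h0
      have : w = 0 := by rw [hw, hSdef, h0, Nat.primeFactors_zero, card_empty]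
      rw [this] at hw1
      have : (1 : ℝ) < W₀ := by
        rw [hW₀]; exact Real.one_lt_exp_iff.mpr (by positivity)
      push_cast at hw1; linarith
    have h2 : ((w : ℝ) + 1) * (Real.log ((w : ℝ) + 1) - 1) ≤ Real.log D := by
      have hprod : (∏ q ∈ S, q) ∣ D := Nat.prod_primeFactors_dvd D
      have hle : ((∏ q ∈ S, q : ℕ) : ℝ) ≤ D := by exact_mod_cast Nat.le_of_dvd (Nat.pos_of_ne_zero hD0) hprod
      have hprodpos : 0 < ((∏ q ∈ S, q : ℕ) : ℝ) := by
        have : 0 < ∏ q ∈ S, q := prod_pos fun q hq => (Nat.prime_of_mem_primeFactors hq).pos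
        exact_mod_cast this
      have hlog : Real.log ((∏ q ∈ S, q : ℕ) : ℝ) = ∑ q ∈ S, Real.log (q : ℝ) := by
        push_cast
        rw [Real.log_prod]
        intro q hq
        exact_mod_cast (Nat.prime_of_mem_primeFactors hq).ne_zero
      have h3 : ∑ q ∈ S, Real.log (q : ℝ) ≤ Real.log D := by
        rw [← hlog]; exact Real.log_le_log hprodpos hle
      have h4 := sum_range_le_sum_of_monotone (g := fun n : ℕ => Real.log (n : ℝ))
        (fun m n hm hmn => Real.log_le_log (by exact_mod_cast (by omega : 0 < m)) (by exact_mod_cast hmn))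
        S hS2
      have h5 := mul_log_sub_le_sum_log w
      have h6 : ∑ k ∈ range w, Real.log ((k : ℝ) + 2) = ∑ k ∈ range S.card, Real.log (((k + 2 : ℕ)) : ℝ) := by
        rw [hw]; refine sum_congr rfl fun k _ => ?_; push_cast; ring_nf
      linarith [h6 ▸ h5]
    have hwpos : (0 : ℝ) < (w : ℝ) + 1 := by positivity
    have h3 : ((w : ℝ) + 1) * (10 : ℝ) ^ 10 ≤ Real.log D :=
      le_trans (mul_le_mul_of_nonneg_left hlogw hwpos.le) h2
    -- step 3: `10 (w+1)^{1/10} = ((w+1)·10^10)^{1/10} ≤ (log D)^{1/10}`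
    have h4 : 10 * ((w : ℝ) + 1) ^ (1 / 10 : ℝ) = (((w : ℝ) + 1) * (10 : ℝ) ^ 10) ^ (1 / 10 : ℝ) := by
      rw [Real.mul_rpow hwpos.le (by positivity)]
      have : ((10 : ℝ) ^ 10) ^ (1 / 10 : ℝ) = 10 := by
        rw [← Real.rpow_natCast (10 : ℝ) 10, ← Real.rpow_mul (by norm_num)]; norm_num
      rw [this, mul_comm]
    have h5 : (((w : ℝ) + 1) * (10 : ℝ) ^ 10) ^ (1 / 10 : ℝ) ≤ Real.log D ^ (1 / 10 : ℝ) :=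
      Real.rpow_le_rpow (by positivity) h3 (by norm_num)
    have hc0 : 0 ≤ 10 * (W₀ + 1) ^ (1 / 10 : ℝ) := by positivity
    linarith

end Literature.NumberTheory.LFunctions.Zhang2022.Lemma153Rp
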